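import Literature.Probability.Percolation.ArmSeparationNearCriticalFour
import Literature.Probability.Percolation.FourArmSeparationFacts
import Literature.Probability.Percolation.AltFourArmSeparationNearCritical
import HarnessLib

/-!
# Discharge of the two alternating four-arm separation facts

Topic `Literature/Probability/Percolation`; family `crit-perc` / near-critical percolation on the
triangular lattice `𝕋`. PROOFS ONLY (no definition, no named fact). The near-critical
arm-separation theorem for four arms of alternating colours — P. Nolin, *Near-critical
percolation in two dimensions*, EJP 13 (2008), §4.3 Thm. 11 for `j = 4`, `σ = BWBW`
[arXiv 0711.4948: Thm. 10], proved in §4.4; after H. Kesten, CMP 109 (1987), Lemmas 4–6 — is a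
THEOREM of the tree: `altSeparation_display` (`ArmSeparationNearCriticalFour.lean`, the assembly
of the outer scheme, the inner scheme, the untwisting, the inward extensions, the half-step
conversion and the bounded-ratio estimate, with the RSW inputs below Werner's length
`L(t, ε) = charLengthW ε t`). Two named facts of the tree record exactly this display, verbatim —
`Nolin2008_altFourArm_separation` (`FourArmSeparationFacts.lean`, hypothesis `hsepA` of the
assembly of `θ(p) = (p - 1/2)^{5/36+o(1)}`) and `Nolin2008_altFourArm_separation_nearCritical`
(`AltFourArmSeparationNearCritical.lean`, the named leaf of Werner's one-arm stability) — and are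
discharged here by that theorem.

* `Nolin2008_altFourArm_separation_holds`, `Nolin2008_altFourArm_separation_nearCritical_holds` —
  the two discharges (the one-arm consequences `Werner2009_oneArm_nearCritical_holds`,
  `Werner2009_oneArm_logDeriv_holds`, `Nolin2008_thm27_oneArm_holds` are already theorems of
  `NearCriticalOneArmThetaHolds.lean` and are not repeated).

## References

* P. Nolin, Near-critical percolation in two dimensions, *Electron. J. Probab.* 13 (2008)
  1562–1623, §4.3 Thm. 11, §4.4 (arXiv 0711.4948: Thm. 10 and its proof) [Nolin2008].
* H. Kesten, Scaling relations for 2D-percolation, *Comm. Math. Phys.* 109 (1987) 109–156,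
  Lemmas 4–6 [KestenScalingCMP1987].
* W. Werner, *Lectures on two-dimensional critical percolation*, IAS/Park City Math. Ser. 16
  (2009), Lecture 6, Prop. 6.1 [WernerPCMI2009].

Tree: `altSeparation_display` (`ArmSeparationNearCriticalFour.lean`);
`Nolin2008_altFourArm_separation` (`FourArmSeparationFacts.lean`);
`Nolin2008_altFourArm_separation_nearCritical` (`AltFourArmSeparationNearCritical.lean`).
-/

noncomputable section

namespace Literature.Probability.Percolation

/-- **Nolin's Thm. 11 for four alternating arms, near criticality — the named fact
`Nolin2008_altFourArm_separation` is a theorem**: it is verbatim the tree's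
`altSeparation_display`. [cite: Nolin2008, §4.3 Thm. 11, j = 4, σ = BWBW (arXiv 0711.4948: Thm. 10)] -/
theorem Nolin2008_altFourArm_separation_holds : Nolin2008_altFourArm_separation :=
  altSeparation_display

/-- **The named leaf `Nolin2008_altFourArm_separation_nearCritical` is a theorem**: verbatim the
tree's `altSeparation_display`. [cite: Nolin2008, §4.3 Thm. 11, j = 4, σ = BWBW (arXiv 0711.4948: Thm. 10)] -/
theorem Nolin2008_altFourArm_separation_nearCritical_holds :
    Nolin2008_altFourArm_separation_nearCritical :=
  altSeparation_display

end Literature.Probability.Percolation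

end
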